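import Summits.ABC.IUTFork.DAGL1e
import Summits.ABC.IUTFork.DAGL1t
import Summits.ABC.IUTFork.DAGL6b
import Summits.ABC.IUTFork.DAGL6d
import Summits.ABC.IUTFork.DAGL6t

/-!
# Kernel DAG index — witness UPGRADE part c (GENERATED by abc-iut-c312-2 gen 4 `work/gen_index.py upgrade` @2026-08-26T06:03Z from HOME/plan/DAG.tsv
(regenerated 2026-08-26T06:00:22Z); spec v1.3 §2(c) "`_holds` iff the DAG row is discharged", §5 "re-file when nodes change status")

THIS FILE PROVES NOTHING NEW AND ASSERTS NOTHING. For 7 nodes ALREADY INDEXED with a partial witness `N_<id>_part` (their DAG row was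
`landed(p…)` when indexed) whose row is NOW `discharged(p…)`, it adds the discharge witness `N_<id>_holds : N_<id> := N_<id>_part` BY NAME —
the node statement `N_<id>` is untouched (append-only across files: nothing landed is redefined). Nothing here says abc is proved or refuted
or takes a side on [IUTchIII] Cor 3.12. typed ≠ discharged; indexed ≠ endorsed.
-/

namespace Summit.ABC.IUTFork.DAG

/-- [node FrdII:Ex1.1(i) · L1/D1 · DAG status discharged(p405196)] discharge witness of `N_FrdII_Ex1_1_i` (indexed in `DAGL1t` with `_part` while the row was landed; now discharged, p405196): BY NAME; proves nothing new. -/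
theorem N_FrdII_Ex1_1_i_holds : N_FrdII_Ex1_1_i := N_FrdII_Ex1_1_i_part

/-- [node FrdII:Ex1.3(i) · L1/D1 · DAG status discharged(p404448)] discharge witness of `N_FrdII_Ex1_3_i` (indexed in `DAGL1e` with `_part` while the row was landed; now discharged, p404448): BY NAME; proves nothing new. -/
theorem N_FrdII_Ex1_3_i_holds : N_FrdII_Ex1_3_i := N_FrdII_Ex1_3_i_part

/-- [node FrdII:Ex1.3(ii) · L1/D1 · DAG status discharged(p404448)] discharge witness of `N_FrdII_Ex1_3_ii` (indexed in `DAGL1e` with `_part` while the row was landed; now discharged, p404448): BY NAME; proves nothing new. -/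
theorem N_FrdII_Ex1_3_ii_holds : N_FrdII_Ex1_3_ii := N_FrdII_Ex1_3_ii_part

/-- [node IUTchII:Prop4.1(iv) · L6/D2 · DAG status discharged(p404520)] discharge witness of `N_IUTchII_Prop4_1_iv` (indexed in `DAGL6d` with `_part` while the row was landed; now discharged, p404520): BY NAME; proves nothing new. -/
theorem N_IUTchII_Prop4_1_iv_holds : N_IUTchII_Prop4_1_iv := N_IUTchII_Prop4_1_iv_part

/-- [node IUTchIII:Prop1.3(ii) · L6/D3 · DAG status discharged(p406456)] discharge witness of `N_IUTchIII_Prop1_3_ii` (indexed in `DAGL6t` with `_part` while the row was landed; now discharged, p406456): BY NAME; proves nothing new. -/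
theorem N_IUTchIII_Prop1_3_ii_holds : N_IUTchIII_Prop1_3_ii := N_IUTchIII_Prop1_3_ii_part

/-- [node IUTchIII:Prop1.3(iv) · L6/D3 · DAG status discharged(p406456)] discharge witness of `N_IUTchIII_Prop1_3_iv` (indexed in `DAGL6b` with `_part` while the row was landed; now discharged, p406456): BY NAME; proves nothing new. -/
theorem N_IUTchIII_Prop1_3_iv_holds : N_IUTchIII_Prop1_3_iv := N_IUTchIII_Prop1_3_iv_part

/-- [node IUTchIII:Ex3.6(ii) · L6/D3 · DAG status discharged(p412161)] discharge witness of `N_IUTchIII_Ex3_6_ii` (indexed in `DAGL6b` with `_part` while the row was landed; now discharged, p412161): BY NAME; proves nothing new. -/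
theorem N_IUTchIII_Ex3_6_ii_holds : N_IUTchIII_Ex3_6_ii := N_IUTchIII_Ex3_6_ii_part

end Summit.ABC.IUTFork.DAG
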